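import Summits.ResolutionOfSingularities.ResolutionOfSingularities.Theorems.ValuativeLuAlphaPTorsorPerronMonomialization
import HarnessLib

/-!
# Perron monomialization on very good charts — explicit form (S3⁺)

Crux `Valuative.LuAlphaPTorsor` (stmt-ResolutionOfSingularities-0641), line `pfaff-line-log-final-forms`,
lead c4 — groundwork for the rank `≥ 2` Abhyankar core `stub_abhyankarHigherRankCore`: the landed
S3 `stub_perronMonomialization` records only the EXISTENCE of the re-parametrized chart; the
level-by-level monomialization on the coarsenings of a higher-rank place needs the construction
itself (`R' = R[x']`, `x'ⱼ = ∏ xᵢ^{C j i}` Laurent monomials of positive value). Same proof.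
-/

set_option linter.dupNamespace false

open IsLocalRing

namespace Summit.ResolutionOfSingularities.ResolutionOfSingularities.Theorems.PfaffLine

open Literature.AlgebraicGeometry.Resolution

/-- **Perron monomialization, explicit form** (S3⁺): the registered S3 `stub_perronMonomialization`
with three more conclusions recording the CONSTRUCTION — `R' = R[x']`, each `x'ⱼ` a Laurent
monomial in the `xᵢ`, and `v(x'ⱼ) < 1` — needed to run the monomialization level by level on the
coarsenings of a higher-rank place (population (b) of the open core). Proof verbatim the worker's
(w-S3) proof of S3. [folklore] -/
theorem perronMonomialization_explicit :
    ∀ (k K : Type) [Field k] [Field K] [Algebra k K] (O : ValuationSubring K) (n : ℕ) (R : Subalgebra k K) (hRO : R.toSubring ≤ O.toSubring) (x : Fin n → K) (hx : ∀ i, x i ∈ R), R.FG → (∀ i, x i ≠ 0) → Ideal.span (Set.range fun i => (⟨x i, hx i⟩ : R.toSubring)) = Ideal.comap (Subring.inclusion hRO) (IsLocalRing.maximalIdeal O) → (∀ m : Fin n → ℤ, (∏ i, O.valuation (x i) ^ (m i)) = 1 → m = 0) → (∀ z w : K, O.valuation z < 1 → w ≠ 0 → ∃ N : ℕ, O.valuation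 z ^ N < O.valuation w) → ∀ (m : ℕ) (a : Fin m → K), (∀ j, a j ∈ R ∧ a j ≠ 0) → ∀ (l : ℕ) (h : Fin l → Fin n → ℤ), (∀ j, (∏ i, O.valuation (x i) ^ (h j i)) ≤ 1) → ∃ (R' : Subalgebra k K) (hR'O : R'.toSubring ≤ O.toSubring) (x' : Fin n → K) (hx' : ∀ i, x' i ∈ R'), R ≤ R' ∧ R'.FG ∧ ((R' : Set K) ⊆ Subfield.closure (R : Set K)) ∧ (∀ i, x' i ≠ 0) ∧ Ideal.span (Set.range fun i => (⟨x' i, hx' i⟩ : R'.toSubring)) = Ideal.comap (Subring.inclusion hR'O) (IsLocalRing.maximalIdeal O) ∧ (∀ m : Fin n → ℤ, (∏ i, O.valuation (x' i) ^ (m i)) = 1 → m = 0) ∧ (∀ i, ∃ d : Fin n → ℕ, x i = ∏ j, x' j ^ (d j)) ∧ (∀ j, ∃ (α : Fin n → ℕ) (u : K), u ∈ R' ∧ O.valuation u = 1 ∧ a j = (∏ i, x' i ^ (α i)) * u) ∧ (∀ j, ∃ e : Fin n → ℕ, (∏ i, x i ^ (h j i)) = ∏ i, x' i ^ (e i)) ∧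 R' = Algebra.adjoin k ((R : Set K) ∪ Set.range x') ∧ (∀ j, ∃ c : Fin n → ℤ, x' j = ∏ i, x i ^ (c i)) ∧ (∀ j, O.valuation (x' j) < 1) := by
  intro k K _ _ _ O n R hRO x hx hRFG hx0 hcen hind harch m a ha l h hh
  classical
  have hvx0 : ∀ i, O.valuation (x i) ≠ 0 := fun i => (map_ne_zero O.valuation).mpr (hx0 i)
  have hxlt : ∀ i, O.valuation (x i) < 1 := fun i =>
    (perron_mem_centre_iff O R hRO (hx i)).mp (by rw [← hcen]; exact Ideal.subset_span ⟨i, rfl⟩)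
  -- Steps 1–2: dominant forms of the `a j`
  have hDF := fun j =>
    stub_perronDominantTerm k K O n R hRO x hx hx0 hcen hind harch (a j) (ha j).1 (ha j).2
  choose P μ₀ hμ₀ hPR hv1 hdom hPe using hDF
  -- Step 3: the finite set of exponent vectors handed to Knaf–Kuhlmann's Lemma 4.2
  let H : Finset (Fin n → ℤ) :=
    (Finset.univ.biUnion fun j => (P j).support.image
        fun μ => fun i => (μ i : ℤ) - (μ₀ j i : ℤ)) ∪
      (Finset.univ.image fun j => fun i => (μ₀ j i : ℤ)) ∪
      (Finset.univ.image h) ∪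
      (Finset.univ.image fun i => (Pi.single i 1 : Fin n → ℤ))
  have hH1 : ∀ j, ∀ μ ∈ (P j).support, (fun i => (μ i : ℤ) - (μ₀ j i : ℤ)) ∈ H := by
    intro j μ hμ
    simp only [H, Finset.mem_union, Finset.mem_biUnion, Finset.mem_image, Finset.mem_univ,
      true_and]
    exact Or.inl (Or.inl (Or.inl ⟨j, μ, hμ, rfl⟩))
  have hH2 : ∀ j, (fun i => (μ₀ j i : ℤ)) ∈ H := by
    intro j
    simp only [H, Finset.mem_union, Finset.mem_biUnion, Finset.mem_image, Finset.mem_univ,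
      true_and]
    exact Or.inl (Or.inl (Or.inr ⟨j, rfl⟩))
  have hH3 : ∀ j, h j ∈ H := by
    intro j
    simp only [H, Finset.mem_union, Finset.mem_biUnion, Finset.mem_image, Finset.mem_univ,
      true_and]
    exact Or.inl (Or.inr ⟨j, rfl⟩)
  have hH4 : ∀ i, (Pi.single i 1 : Fin n → ℤ) ∈ H := by
    intro i
    simp only [H, Finset.mem_union, Finset.mem_biUnion, Finset.mem_image, Finset.mem_univ,
      true_and]
    exact Or.inr ⟨i, rfl⟩
  have hH : ∀ g ∈ H, (∏ i, O.valuation (x i) ^ (g i)) ≤ 1 := by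
    intro g hg
    simp only [H, Finset.mem_union, Finset.mem_biUnion, Finset.mem_image, Finset.mem_univ,
      true_and] at hg
    rcases hg with ((⟨j, μ, hμ, rfl⟩ | ⟨j, rfl⟩) | ⟨j, rfl⟩) | ⟨i, rfl⟩
    · have hle : (∏ i, O.valuation (x i) ^ (μ i)) ≤ ∏ i, O.valuation (x i) ^ (μ₀ j i) := by
        by_cases hne : μ = μ₀ j
        · rw [hne]
        · exact (hdom j μ hμ hne).le
      have heq : (∏ i, O.valuation (x i) ^ ((μ i : ℤ) - (μ₀ j i : ℤ))) =
          (∏ i, O.valuation (x i) ^ (μ i)) / ∏ i, O.valuation (x i) ^ (μ₀ j i) := by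
        rw [← Finset.prod_div_distrib]
        refine Finset.prod_congr rfl fun i _ => ?_
        rw [zpow_sub₀ (hvx0 i), zpow_natCast, zpow_natCast]
      rw [heq]
      exact div_le_one_of_le₀ hle zero_le
    · simp only [zpow_natCast]
      exact Finset.prod_le_one' fun i _ => pow_le_one' (hxlt i).le _
    · exact hh j
    · rw [← valuation_prod_zpow x O, prod_zpow_single]
      exact (hxlt i).le
  obtain ⟨C, D, hCD, -, hpos, hexp⟩ :=
    knafKuhlmann2005_lemma42_matrix O.ValueGroup n (fun i => O.valuation (x i)) hvx0 hind H hH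
  -- Step 4: the new parameters `x'ⱼ = x^{Cⱼ}`
  set x' : Fin n → K := fun j => ∏ i, x i ^ (C j i) with hx'def
  have hx'j : ∀ j, x' j = ∏ i, x i ^ (C j i) := fun j => rfl
  have hvx' : ∀ j, O.valuation (x' j) = ∏ i, O.valuation (x i) ^ (C j i) := fun j =>
    valuation_prod_zpow x O (C j)
  have hx'lt : ∀ j, O.valuation (x' j) < 1 := fun j => by rw [hvx']; exact hpos j
  have hx'0 : ∀ j, x' j ≠ 0 := fun j => prod_zpow_ne_zero x hx0 _
  have hmono : ∀ g ∈ H, ∃ e : Fin n → ℕ, (∏ i, x i ^ (g i)) = ∏ j, x' j ^ (e j) := by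
    intro g hg
    obtain ⟨e, he⟩ := hexp g hg
    exact ⟨e, perron_prod_zpow_eq_prod_pow x hx0 C x' hx'j g e he⟩
  -- the ring `R' = R[x']`
  let R' : Subalgebra k K := Algebra.adjoin k ((R : Set K) ∪ Set.range x')
  have hRR' : R ≤ R' := fun z hz => Algebra.subset_adjoin (Or.inl hz)
  have hx'R' : ∀ j, x' j ∈ R' := fun j => Algebra.subset_adjoin (Or.inr ⟨j, rfl⟩)
  let OK : Subalgebra k K :=
    { O.toSubring with algebraMap_mem' := fun c => hRO (R.algebraMap_mem c) }
  have hR'OK : R' ≤ OK := by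
    refine Algebra.adjoin_le ?_
    rintro z (hz | ⟨j, rfl⟩)
    · exact hRO hz
    · exact (O.valuation_le_one_iff _).mp (hx'lt j).le
  have hR'O : R'.toSubring ≤ O.toSubring := fun z hz => hR'OK hz
  let FK : Subalgebra k K :=
    { (Subfield.closure (R : Set K)).toSubring with
      algebraMap_mem' := fun c => Subfield.subset_closure (R.algebraMap_mem c) }
  have hR'FK : R' ≤ FK := by
    refine Algebra.adjoin_le ?_
    rintro z (hz | ⟨j, rfl⟩)
    · exact Subfield.subset_closure hz
    · exact prod_zpow_mem x (fun i => Subfield.subset_closure (hx i)) (C j)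
  have hsub : (R' : Set K) ⊆ Subfield.closure (R : Set K) := fun z hz => hR'FK hz
  have hFG : R'.FG := by
    obtain ⟨s, hs⟩ := hRFG
    refine ⟨s ∪ Finset.univ.image x', ?_⟩
    rw [Finset.coe_union, Finset.coe_image, Finset.coe_univ, Set.image_univ,
      Algebra.adjoin_union, hs]
    show R ⊔ Algebra.adjoin k (Set.range x') = Algebra.adjoin k ((R : Set K) ∪ Set.range x')
    rw [Algebra.adjoin_union, Algebra.adjoin_eq]
  -- the old parameters are monomials in the new ones
  have hxd : ∀ i, ∃ d : Fin n → ℕ, x i = ∏ j, x' j ^ (d j) := by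
    intro i
    obtain ⟨e, he⟩ := hmono _ (hH4 i)
    rw [prod_zpow_single] at he
    exact ⟨e, he⟩
  -- Step 5: the centre of `R'`
  have hxJ : ∀ i, (⟨x i, hRR' (hx i)⟩ : R'.toSubring) ∈
      Ideal.span (Set.range fun j => (⟨x' j, hx'R' j⟩ : R'.toSubring)) := by
    intro i
    obtain ⟨d, hd⟩ := hxd i
    have hd0 : d ≠ 0 := by
      rintro rfl
      simp only [Pi.zero_apply, pow_zero, Finset.prod_const_one] at hd
      exact (hxlt i).ne (by rw [hd, map_one])
    obtain ⟨j, hj⟩ := Function.ne_iff.mp hd0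
    have heq : (⟨x i, hRR' (hx i)⟩ : R'.toSubring) =
        ∏ j, (⟨x' j, hx'R' j⟩ : R'.toSubring) ^ (d j) :=
      Subtype.ext (by push_cast; exact hd)
    rw [heq]
    exact perron_prod_pow_mem_span _ d hj
  have hcentre := perron_span_eq_centre O R hRO x hx hcen x' R' rfl hR'O hRR' hx'R' hx'lt hxJ
  -- Step 6: value independence of `x'`
  have hind' := perron_valIndep_of_matrix O x hx0 hind C D hCD x' hx'j
  -- Step 7: the `a j`
  have haj : ∀ j, ∃ (α : Fin n → ℕ) (u : K), u ∈ R' ∧ O.valuation u = 1 ∧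
      a j = (∏ i, x' i ^ (α i)) * u := by
    intro j
    obtain ⟨α, hα⟩ := hmono _ (hH2 j)
    refine perron_exists_monomial_mul_unit O R R' hRO hRR' x hx0 x' hx'R' (P j) (μ₀ j) (hμ₀ j)
      (hPR j) (hv1 j) (hdom j) (hPe j) α hα fun μ hμ => ?_
    obtain ⟨e, he⟩ := hmono _ (hH1 j μ hμ)
    exact ⟨e, he⟩
  have hhj : ∀ j, ∃ e : Fin n → ℕ, (∏ i, x i ^ (h j i)) = ∏ i, x' i ^ (e i) := fun j =>
    hmono _ (hH3 j)
  exact ⟨R', hR'O, x', hx'R', hRR', hFG, hsub, hx'0, hcentre, hind', hxd, haj, hhj, rfl,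
    fun j => ⟨C j, rfl⟩, hx'lt⟩

end Summit.ResolutionOfSingularities.ResolutionOfSingularities.Theorems.PfaffLine
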